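import Summits.ValiantsHypothesis.ValiantsHypothesis.Theorems.LacunarySymmetroidMatrixDescartesDoorA26WallBubblingSignCut

/-!
# `DoorA26` / line `wall_bubbling` — the κ-FLIP COUNT for a frame of any length (honest encoding on `n + 2` abscissae)

HONEST FRAMING.  Object-search cell `pub-symmetroid`, crux `Theses.LacunarySymmetroid.DoorA26` (stmt-ValiantsHypothesis-19979; OPEN, typed,
never asserted).  W2 seat val-sym-door-p1 g19, file #77; def-free helper for obligation (R) of `Cruxes/DoorA26/Lines/wall_bubbling.lean`.
#54 `card_kappaFlips_le` counts the flips of the alternating virtual signs `κ` along a touch set in the 21-abscissa frame (flips + 2|J| ≤ 20);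
the order-3 / order-4 dual analyses (memo `DOOR-A26-P1G19-NO-BALANCE.md` §7c) live in frames with 19 / 18 outer abscissae.  This file is the same
count for `Fin (n + 2)` verbatim (`sign_run`, `card_filter_lt_succ` reused from #54).  Imports #54 `…SignCut`.

WHAT IS HERE.  `kappa_sign_gen`, `odd_sub_of_kappa_flip_gen`, ★ `card_kappaFlips_le_gen` (flips + 2|J| ≤ n + 1).  Nothing here bears on
`DoorA26`, `DoorA34`, (W)/(M)/(R), `MatrixDescartes` (18050) or `VP ≠ VNP`; registers unchanged.

[folklore] parity bookkeeping.  [this work] the packaging.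
-/

set_option linter.dupNamespace false

namespace Summit.ValiantsHypothesis.ValiantsHypothesis.Theorems.LacunarySymmetroidMatrixDescartes.WallBubbling

open Finset

/-- **The alternating virtual signs** (any length): `κ_j κ_{j+1} < 0` gives `0 < κ₀ κ_j (−1)^j`. [folklore] -/
theorem kappa_sign_gen {n : ℕ} (κ : Fin (n + 2) → ℝ) (halt : ∀ j : Fin (n + 1), κ j.castSucc * κ j.succ < 0) (j : Fin (n + 2)) :
    0 < κ 0 * κ j * (-1) ^ (j : ℕ) := by
  classical
  have hκ : ∀ j, κ j ≠ 0 := by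
    intro j hz
    rcases Fin.eq_castSucc_or_eq_last j with ⟨m, hm⟩ | hlast
    · have := halt m; rw [← hm, hz, zero_mul] at this; exact lt_irrefl _ this
    · have := halt (Fin.last n); rw [Fin.succ_last, ← hlast, hz, mul_zero] at this; exact lt_irrefl _ this
  have hrun := sign_run κ hκ j
  have hall : (Finset.univ.filter fun i : Fin (n + 1) => κ i.castSucc * κ i.succ < 0 ∧ (i : ℕ) < j) =
      Finset.univ.filter fun i : Fin (n + 1) => (i : ℕ) < j := by
    ext i; simp [halt i]
  have hcard : (Finset.univ.filter fun i : Fin (n + 1) => (i : ℕ) < j).card = (j : ℕ) := by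
    have : (Finset.univ.filter fun i : Fin (n + 1) => (i : ℕ) < j) = (Finset.univ : Finset (Fin j)).map
        (Fin.castLEEmb (by have := j.2; omega)) := by
      ext i
      simp only [Finset.mem_filter, Finset.mem_univ, true_and, Finset.mem_map, Fin.castLEEmb_apply]
      constructor
      · intro hi; exact ⟨⟨i, hi⟩, rfl⟩
      · rintro ⟨i', rfl⟩; exact i'.2
    rw [this, Finset.card_map, Finset.card_univ, Fintype.card_fin]
  rw [hall, hcard] at hrun
  exact hrun

/-- **Flips of `κ` are odd index gaps**: if `κ_a κ_b < 0` for `a ≤ b` then `b − a` is odd (any length). [folklore] -/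
theorem odd_sub_of_kappa_flip_gen {n : ℕ} (κ : Fin (n + 2) → ℝ) (halt : ∀ j : Fin (n + 1), κ j.castSucc * κ j.succ < 0) (a b : Fin (n + 2))
    (hab : a ≤ b) (hflip : κ a * κ b < 0) : Odd ((b : ℕ) - a) := by
  have ha := kappa_sign_gen κ halt a
  have hb := kappa_sign_gen κ halt b
  have hprod : 0 < (κ 0 * κ a * (-1) ^ (a : ℕ)) * (κ 0 * κ b * (-1) ^ (b : ℕ)) := mul_pos ha hb
  have hre : (κ 0 * κ a * (-1) ^ (a : ℕ)) * (κ 0 * κ b * (-1) ^ (b : ℕ)) =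
      (κ 0) ^ 2 * ((-1) ^ (a : ℕ)) ^ 2 * ((κ a * κ b) * (-1) ^ ((b : ℕ) - a)) := by
    have : (-1 : ℝ) ^ (b : ℕ) = (-1) ^ (a : ℕ) * (-1) ^ ((b : ℕ) - a) := by
      rw [← pow_add]; congr 1; omega
    rw [this]; ring
  rw [hre] at hprod
  have h1 : 0 < (κ 0) ^ 2 * ((-1 : ℝ) ^ (a : ℕ)) ^ 2 := by
    have h0 : κ 0 ≠ 0 := by
      intro hz; have := halt 0; rw [show (0 : Fin (n + 1)).castSucc = 0 from rfl, hz, zero_mul] at this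
      exact lt_irrefl _ this
    positivity
  have h2 : 0 < (κ a * κ b) * (-1 : ℝ) ^ ((b : ℕ) - a) := pos_of_mul_pos_right hprod h1.le
  by_contra hodd
  rw [Nat.not_odd_iff_even] at hodd
  rw [hodd.neg_one_pow, mul_one] at h2
  exact lt_irrefl _ (h2.trans hflip)

/-- **Counting the flips of `κ` along an honestly encoded touch set (any frame length).**  If `J ⊆ Fin (n+2)` (with `|J| = k + 1`) avoids the
first and the last abscissa and contains no two adjacent indices, then the number of consecutive gaps of `J` across which the alternating `κ` flips
is at most `(n + 1) − 2|J|` (for `n = 20`: #54 `card_kappaFlips_le`; for the 19-abscissa frame of an order-3 profile, `n = 17`: flips ≤ 18 − 2|J|). [this work] -/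
theorem card_kappaFlips_le_gen {n : ℕ} (J : Finset (Fin (n + 2))) {k : ℕ} (h : J.card = k + 1) (κ : Fin (n + 2) → ℝ)
    (halt : ∀ j : Fin (n + 1), κ j.castSucc * κ j.succ < 0) (h0 : (0 : Fin (n + 2)) ∉ J) (h20 : Fin.last (n + 1) ∉ J)
    (hsep : ∀ j : Fin (n + 1), j.castSucc ∈ J → j.succ ∉ J) :
    (Finset.univ.filter fun i : Fin k =>
        κ (J.orderEmbOfFin h i.castSucc) * κ (J.orderEmbOfFin h i.succ) < 0).card + 2 * (k + 1) ≤ n + 1 := by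
  classical
  set e := J.orderEmbOfFin h with he
  set F := Finset.univ.filter fun i : Fin k => κ (e i.castSucc) * κ (e i.succ) < 0 with hF
  have hemem : ∀ i, e i ∈ J := fun i => by rw [he]; exact J.orderEmbOfFin_mem h i
  -- consecutive gaps have length ≥ 2, flip gaps ≥ 3
  have hgap : ∀ i : Fin k, ((e i.castSucc : Fin (n + 2)) : ℕ) + 2 + (if i ∈ F then 1 else 0) ≤ ((e i.succ : Fin (n + 2)) : ℕ) := by
    intro i
    have hlt : e i.castSucc < e i.succ := e.strictMono Fin.castSucc_lt_succ
    have hlt' : ((e i.castSucc : Fin (n + 2)) : ℕ) < ((e i.succ : Fin (n + 2)) : ℕ) := hlt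
    -- not adjacent
    have hne : ((e i.castSucc : Fin (n + 2)) : ℕ) + 1 ≠ ((e i.succ : Fin (n + 2)) : ℕ) := by
      intro hadj
      have hlt20 : ((e i.castSucc : Fin (n + 2)) : ℕ) < n + 1 := by have := (e i.succ).2; omega
      have h1 := hsep ⟨(e i.castSucc : Fin (n + 2)), hlt20⟩
      have hc : (⟨((e i.castSucc : Fin (n + 2)) : ℕ), hlt20⟩ : Fin (n + 1)).castSucc = e i.castSucc := Fin.ext rfl
      have hs : (⟨((e i.castSucc : Fin (n + 2)) : ℕ), hlt20⟩ : Fin (n + 1)).succ = e i.succ := Fin.ext (by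
        rw [Fin.val_succ]; exact hadj)
      rw [hc, hs] at h1
      exact h1 (hemem _) (hemem _)
    split_ifs with hi
    · have hflip := (Finset.mem_filter.1 hi).2
      have hodd := odd_sub_of_kappa_flip_gen κ halt (e i.castSucc) (e i.succ) hlt.le hflip
      obtain ⟨r, hr⟩ := hodd
      omega
    · omega
  -- running count: `e i₀ ≥ e 0 + 2 i₀ + #(flips below i₀)`
  have hrun : ∀ i₀ : Fin (k + 1), ((e 0 : Fin (n + 2)) : ℕ) + 2 * (i₀ : ℕ) +
      (F.filter fun i : Fin k => (i : ℕ) < i₀).card ≤ ((e i₀ : Fin (n + 2)) : ℕ) := by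
    intro i₀
    induction i₀ using Fin.induction with
    | zero =>
      have : (F.filter fun i : Fin k => (i : ℕ) < ((0 : Fin (k + 1)) : ℕ)) = ∅ := by ext i; simp
      rw [this]; simp
    | succ i₀ ih =>
      rw [card_filter_lt_succ F i₀]
      have := hgap i₀
      have hcs : ((i₀.castSucc : Fin (k + 1)) : ℕ) = (i₀ : ℕ) := Fin.val_castSucc i₀
      rw [Fin.val_succ]
      rw [hcs] at ih
      simp only [hcs] at *
      omega
  have hlast := hrun (Fin.last k)
  have hfull : (F.filter fun i : Fin k => (i : ℕ) < ((Fin.last k : Fin (k + 1)) : ℕ)) = F := by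
    ext i; simp only [Finset.mem_filter, Fin.val_last, and_iff_left_iff_imp]; exact fun _ => i.2
  rw [hfull] at hlast
  -- e 0 ≥ 1 and e last ≤ n
  have h0' : 1 ≤ ((e 0 : Fin (n + 2)) : ℕ) := by
    by_contra hlt
    have : e 0 = 0 := Fin.ext (by rw [Fin.val_zero]; omega)
    exact h0 (this ▸ hemem 0)
  have h19 : ((e (Fin.last k) : Fin (n + 2)) : ℕ) ≤ n := by
    by_contra hlt
    have : e (Fin.last k) = Fin.last (n + 1) := Fin.ext (by have := (e (Fin.last k)).2; rw [Fin.val_last]; omega)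
    exact h20 (this ▸ hemem _)
  rw [Fin.val_last] at hlast
  omega

end Summit.ValiantsHypothesis.ValiantsHypothesis.Theorems.LacunarySymmetroidMatrixDescartes.WallBubbling
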